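import Summits.QuantumFields.YangMills.Theorems.PoincareLipschitzOrbitMinFlatShadowLetters
import Summits.QuantumFields.YangMills.Theorems.PoincareLipschitzOrbitMinOneSiteSphere
import HarnessLib

/-!
# Crux stmt-QuantumFields-19936 `UnitScaleTilt.HistoryTailL`, route crux `PoincareLipschitz.BlockLipschitzL` (stmt-QuantumFields-23533), K2 organ «LOC-REG-MIN» (`hReg`) —
# [T2] THE FLAT SHADOW OF A TORUS ORBIT MINIMISER: the box-`ℓ²`-gauge-orbit minimiser `h` of `hReg`'s clause, read through `SU(2) → S³ ⊂ ℝ⁴` along an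
# equivariant chart `c : ℤ^d → T`, IS a unit field `u : ℤ^d → EuclideanSpace ℝ (Fin 4)` with bond twists `τ μ y : ℝ⁴ ≃ₗᵢ ℝ⁴` in the (V, τ) letters of
# ✓`PoincareLipschitzCovariantCaccioppoli` ∕ ✓`…CovariantDirichlet` ∕ ✓`…SphereMapSmallRangeEnergyDecay`: energy dictionary, twist defect, twisted one-site
# optimality `‖N y‖•u y = N y`, and LOCAL MINIMALITY under sphere-valued variations supported in a charted box

Cell `ym3-torus` (YM ladder rung R3 = continuum SU(2) Yang–Mills on T³ — a RUNG, NOT the Clay problem: not d = 4, not infinite volume, not a mass gap); LEAD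
seat `ym-ust-19936-w1` g8 (bus 2026-08-29T05:29Z RULING «K2 END-GAME ARCHITECTURE» + 05:32Z CLAIM [T2]).  Helper `--supports stmt-QuantumFields-19936`; THEOREMS
ONLY (0 `def`, 0 `sorry`, default heartbeats; every object is written out or `∃`-packaged).  FILE 2∕2 of [T2] over ✓`PoincareLipschitzOrbitMinFlatShadowLetters`.
Nothing here proves `hImprove`, `hReg`, a chart, a stub, `BlockLipschitzL`, `HistoryTailL` or a summit statement.

WHY.  The K2 end-game knit of record is `hRegH ⟸ hImprove ∧ [A] ∧ [C] ∧ [D]`: [A] (stability ⇒ bounded normalised energy, ✓`…OrbitMinBoxEnergy`) speaks the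
torus `SU(2)` letters of `hReg`; `hImprove` (THE ORGAN: energy improvement at bounded normalised energy), [C] (E→R: small energy ⇒ small range — MINIMALITY is
used) and [D] (small range ⇒ Hölder bond law — only ONE-SITE OPTIMALITY is used) speak the flat-shadow letters `u : Zd d → V`, `τ : Fin d → Zd d → (V ≃ₗᵢ[ℝ] V)`,
energy `Σ‖τ μ y (u(y+e_μ)) − u y‖²`.  This file is the hinge: ✓`PoincareLipschitzSU2SphereDictionary` (`dist1_bond_sq_eq`, `exists_su2_coords_eq`) and
✓`PoincareLipschitzOrbitMinOneSiteSphere` (`oneSite_euler_lagrange`) transported to `EuclideanSpace ℝ (Fin 4)` along the chart.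

WHAT IS PROVED (ns `…Theorems.PoincareLipschitzOrbitMinFlatShadow`; `v(g) = (Re g₀₀, Im g₀₀, Re g₁₀, Im g₁₀)`, `toLp 2 : (Fin 4 → ℝ) → EuclideanSpace ℝ (Fin 4)`).
* §1 ★★★ `exists_flatShadow (V W S h) (hmin : <hReg's orbit-min clause on S, VERBATIM shape of ✓(T) `leungXin_inputs_of_orbitMin`>) (c) (hc : equivariant)` :
  `∃ u τ`, (a₀) `u y = toLp (v (h (c y)))` · (a) `‖u y‖ = 1` · (b) `‖τ μ y (u(y+e_μ)) − u y‖² = dist1(V_b·((W^h)_b)⁻¹)²` (`b = ⟨c y, μ⟩`) · (b′) the same for EVERY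
  gauge copy `h′` · (c) `‖τ μ y w − w‖ ≤ √(8(dist1 V_b² + dist1 W_b²))·‖w‖` · (d) `‖N y‖•u y = N y`, `N y = Σ_μ(τ μ y (u(y+e_μ)) + (τ μ (y−e_μ)).symm (u(y−e_μ)))`,
  at every `y` whose `2d` bonds lie in `S` — ✓`smallRange_energy_decay`'s `hopt`, twisted.
* §2 `gaugeAct_gaugeAct_apply`, `sum_ite_mem_univ`, ★★★ `localMin_of_dictionary`: from (a₀) + (b′) + `hmin`, the chart injective on `Q_{R+2}(z)` and all chart bonds
  of `Q_{R+1}(z)` in `S` ⟹ `Σ_{y∈Q_{R+1}(z)}Σ_μ‖τ μ y (u(y+e_μ)) − u y‖² ≤ Σ_{y∈Q_{R+1}(z)}Σ_μ‖τ μ y (v(y+e_μ)) − v y‖²` for every `v` with `v = u` off `Q_R(z)`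
  and `‖v‖ = 1` on `Q_R(z)` (every such `v` is the flat shadow of a gauge copy `k·h`, `k = 1` off `c(Q_R(z))`; the `S`-terms off the chart bonds are untouched).
HONEST SCOPE.  A dictionary; the regularity of the minimisers (`hImprove`, `hReg`) is NOT here.  YM₃ on T³ is rung R3, not Clay; YM gap NOT proved.

References: R. Schoen, K. Uhlenbeck, J. Diff. Geom. 17 (1982) 307–335 [SchoenUhlenbeck1982] (§2: energy-minimising maps, minimality under compactly supported
variations); M. Giaquinta, Annals of Math. Studies 105 (1983) [Giaquinta1984] (Ch. III §1 p.64); Y. L. Xin, Duke Math. J. 47 (1980) 609–613 [Xin1980] (§1);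
T. Bałaban, CMP 98 (1985) 17–51 [Balaban1985Averaging] ((8) p.18: gauge action and its composition).
-/

set_option autoImplicit false

noncomputable section

open scoped BigOperators InnerProductSpace
open Matrix WithLp

namespace Summit.QuantumFields.YangMills.Theorems.PoincareLipschitzOrbitMinFlatShadow

open Literature.MathematicalPhysics.QuantumFieldTheory.Balaban1983to89
open B4Eq19LatticeOperators (Zd box unitVec mem_box box_mono add_unitVec_mem_box sub_unitVec_mem_box)
open Summit.QuantumFields.YangMills.Theorems.PoincareLipschitzSU2SphereDictionary (coords_dot_self dist1_bond_sq_eq exists_su2_coords_eq)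
open Summit.QuantumFields.YangMills.Theorems.PoincareLipschitzOrbitMinFlatShadowLetters
open Summit.QuantumFields.YangMills.Theorems.PoincareLipschitzOrbitMinOneSiteSphere (oneSite_euler_lagrange)

variable {P : Params} {i : ℕ}

/-! ## §1 ★★★ The flat shadow of a box-`ℓ²`-orbit minimiser -/

/-- ★★★ **THE FLAT SHADOW OF A TORUS ORBIT MINIMISER** (dictionary half).  Let `V, W` be `SU(2)` bond fields on the level-`i` torus, `S` a finite set of
bonds, `h` a gauge transformation MINIMISING the `S`-restricted `ℓ²` orbit distance `k ↦ Σ_{b∈S} dist1(V_b·((W^{kh})_b)⁻¹)²` (the clause of «LOC-REG-MIN» ∕ (T)), and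
`c : ℤ^d → T` an equivariant chart (`c(y + e_μ) = c(y) + e_μ`).  Then with `u(y) := v(h(c y)) ∈ S³ ⊂ ℝ⁴` (`v(g) = (Re g₀₀, Im g₀₀, Re g₁₀, Im g₁₀)`) there are bond
twists `τ μ y : ℝ⁴ ≃ₗᵢ ℝ⁴` (the isometries `g ↦ V_b·g·W_b⁻¹`, `b = ⟨c y, μ⟩`) such that: (a) `‖u y‖ = 1`; (b) ENERGY DICTIONARY `‖τ μ y (u(y+e_μ)) − u(y)‖² =
dist1(V_b·((W^h)_b)⁻¹)²`; (c) TWIST DEFECT `‖τ μ y w − w‖ ≤ √(8(dist1 V_b² + dist1 W_b²))·‖w‖`; (d) TWISTED ONE-SITE OPTIMALITY `‖N y‖•u y = N y`,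
`N y = Σ_μ (τ μ y (u(y+e_μ)) + (τ μ (y−e_μ))⁻¹(u(y−e_μ)))`, at every `y` whose `2d` bonds lie in `S` (the discrete harmonic-map equation, from ✓`oneSite_euler_lagrange`).
[cite: Xin1980, §1; SchoenUhlenbeck1982, §2] -/
theorem exists_flatShadow [DecidableEq (PBond P i)]
    (V W : GaugeField P i (Matrix.specialUnitaryGroup (Fin 2) ℂ)) (S : Finset (PBond P i))
    (h : GaugeTransf P i (Matrix.specialUnitaryGroup (Fin 2) ℂ))
    (hmin : ∀ k : GaugeTransf P i (Matrix.specialUnitaryGroup (Fin 2) ℂ),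
      (∑ b : PBond P i, if b ∈ S then GaugeGroup.dist1 (V b * (GaugeField.gaugeAct h W b)⁻¹) ^ 2 else 0) ≤
        ∑ b : PBond P i, if b ∈ S then GaugeGroup.dist1 (V b * (GaugeField.gaugeAct k (GaugeField.gaugeAct h W) b)⁻¹) ^ 2 else 0)
    (c : Zd P.d → Site P i) (hc : ∀ y μ, c (y + unitVec μ) = Site.shift (c y) μ) :
    ∃ (u : Zd P.d → EuclideanSpace ℝ (Fin 4)) (τ : Fin P.d → Zd P.d → (EuclideanSpace ℝ (Fin 4) ≃ₗᵢ[ℝ] EuclideanSpace ℝ (Fin 4))),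
      (∀ y, u y = toLp 2 ![(((h (c y) : Matrix.specialUnitaryGroup (Fin 2) ℂ) : Matrix (Fin 2) (Fin 2) ℂ) 0 0).re,
          (((h (c y) : Matrix.specialUnitaryGroup (Fin 2) ℂ) : Matrix (Fin 2) (Fin 2) ℂ) 0 0).im,
          (((h (c y) : Matrix.specialUnitaryGroup (Fin 2) ℂ) : Matrix (Fin 2) (Fin 2) ℂ) 1 0).re,
          (((h (c y) : Matrix.specialUnitaryGroup (Fin 2) ℂ) : Matrix (Fin 2) (Fin 2) ℂ) 1 0).im]) ∧
      (∀ y, ‖u y‖ = 1) ∧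
      (∀ y μ, ‖τ μ y (u (y + unitVec μ)) - u y‖ ^ 2 = GaugeGroup.dist1 (V ⟨c y, μ⟩ * (GaugeField.gaugeAct h W ⟨c y, μ⟩)⁻¹) ^ 2) ∧
      (∀ (h' : GaugeTransf P i (Matrix.specialUnitaryGroup (Fin 2) ℂ)) (y : Zd P.d) (μ : Fin P.d),
        ‖τ μ y (toLp 2 ![(((h' (c (y + unitVec μ)) : Matrix.specialUnitaryGroup (Fin 2) ℂ) : Matrix (Fin 2) (Fin 2) ℂ) 0 0).re,
              (((h' (c (y + unitVec μ)) : Matrix.specialUnitaryGroup (Fin 2) ℂ) : Matrix (Fin 2) (Fin 2) ℂ) 0 0).im,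
              (((h' (c (y + unitVec μ)) : Matrix.specialUnitaryGroup (Fin 2) ℂ) : Matrix (Fin 2) (Fin 2) ℂ) 1 0).re,
              (((h' (c (y + unitVec μ)) : Matrix.specialUnitaryGroup (Fin 2) ℂ) : Matrix (Fin 2) (Fin 2) ℂ) 1 0).im]) -
            toLp 2 ![(((h' (c y) : Matrix.specialUnitaryGroup (Fin 2) ℂ) : Matrix (Fin 2) (Fin 2) ℂ) 0 0).re,
              (((h' (c y) : Matrix.specialUnitaryGroup (Fin 2) ℂ) : Matrix (Fin 2) (Fin 2) ℂ) 0 0).im,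
              (((h' (c y) : Matrix.specialUnitaryGroup (Fin 2) ℂ) : Matrix (Fin 2) (Fin 2) ℂ) 1 0).re,
              (((h' (c y) : Matrix.specialUnitaryGroup (Fin 2) ℂ) : Matrix (Fin 2) (Fin 2) ℂ) 1 0).im]‖ ^ 2 =
          GaugeGroup.dist1 (V ⟨c y, μ⟩ * (GaugeField.gaugeAct h' W ⟨c y, μ⟩)⁻¹) ^ 2) ∧
      (∀ y μ (w : EuclideanSpace ℝ (Fin 4)),
        ‖τ μ y w - w‖ ≤ Real.sqrt (8 * (GaugeGroup.dist1 (V ⟨c y, μ⟩) ^ 2 + GaugeGroup.dist1 (W ⟨c y, μ⟩) ^ 2)) * ‖w‖) ∧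
      (∀ y, (∀ μ, (⟨c y, μ⟩ : PBond P i) ∈ S) → (∀ μ, (⟨c (y - unitVec μ), μ⟩ : PBond P i) ∈ S) →
        ‖∑ μ, (τ μ y (u (y + unitVec μ)) + (τ μ (y - unitVec μ)).symm (u (y - unitVec μ)))‖ • u y =
          ∑ μ, (τ μ y (u (y + unitVec μ)) + (τ μ (y - unitVec μ)).symm (u (y - unitVec μ)))) := by
  classical
  -- the bond twists, chosen once per chart bond
  have key := fun (μ : Fin P.d) (y : Zd P.d) => exists_bond_twist (V ⟨c y, μ⟩) (W ⟨c y, μ⟩)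
  choose τ hτ hτs hτd using key
  -- local letter for the sphere coordinates
  set cv : Matrix.specialUnitaryGroup (Fin 2) ℂ → (Fin 4 → ℝ) := fun g =>
    ![((g : Matrix (Fin 2) (Fin 2) ℂ) 0 0).re, ((g : Matrix (Fin 2) (Fin 2) ℂ) 0 0).im,
      ((g : Matrix (Fin 2) (Fin 2) ℂ) 1 0).re, ((g : Matrix (Fin 2) (Fin 2) ℂ) 1 0).im] with hcv
  have hcv1 : ∀ g, cv g ⬝ᵥ cv g = 1 := fun g => coords_dot_self (U := g)
  -- (b') the energy dictionary, for every gauge transformation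
  have hdict : ∀ (h' : GaugeTransf P i (Matrix.specialUnitaryGroup (Fin 2) ℂ)) (y : Zd P.d) (μ : Fin P.d),
      ‖τ μ y (toLp 2 (cv (h' (c (y + unitVec μ))))) - toLp 2 (cv (h' (c y)))‖ ^ 2 =
        GaugeGroup.dist1 (V ⟨c y, μ⟩ * (GaugeField.gaugeAct h' W ⟨c y, μ⟩)⁻¹) ^ 2 := by
    intro h' y μ
    have htgt : (⟨c y, μ⟩ : PBond P i).tgt = c (y + unitVec μ) := (hc y μ).symm
    have h1 : τ μ y (toLp 2 (cv (h' (c (y + unitVec μ))))) = toLp 2 (cv (V ⟨c y, μ⟩ * h' (c (y + unitVec μ)) * (W ⟨c y, μ⟩)⁻¹)) :=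
      hτ μ y _
    rw [h1, norm_toLp_sub_sq_of_unit (hcv1 _) (hcv1 _), dist1_bond_sq_eq, htgt, dotProduct_comm]
  refine ⟨fun y => toLp 2 (cv (h (c y))), τ, fun y => rfl, fun y => norm_toLp_eq_one (hcv1 _), fun y μ => hdict h y μ, hdict,
    fun y μ w => hτd μ y w, fun y hS hS' => ?_⟩
  · -- (d) one-site optimality
    have hEL := oneSite_euler_lagrange (fun b => b ∈ S) V W h hmin (c y)
    -- identify the two neighbour sums
    have hsrc : (∑ b : PBond P i, if b ∈ S ∧ b.src = c y then cv (V b * h b.tgt * (W b)⁻¹) else 0) =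
        ∑ μ, cv (V ⟨c y, μ⟩ * h (c (y + unitVec μ)) * (W ⟨c y, μ⟩)⁻¹) := by
      rw [sum_ite_src_eq S (c y) hS]
      refine Finset.sum_congr rfl fun μ _ => ?_
      rw [show (⟨c y, μ⟩ : PBond P i).tgt = c (y + unitVec μ) from (hc y μ).symm]
    have htgt : (∑ b : PBond P i, if b ∈ S ∧ b.tgt = c y then cv ((V b)⁻¹ * h b.src * W b) else 0) =
        ∑ μ, cv ((V ⟨c (y - unitVec μ), μ⟩)⁻¹ * h (c (y - unitVec μ)) * W ⟨c (y - unitVec μ), μ⟩) :=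
      sum_ite_tgt_eq S hc y hS' _
    -- the flat neighbour sum is `toLp` of the torus one
    have hN : (∑ μ, (τ μ y (toLp 2 (cv (h (c (y + unitVec μ))))) + (τ μ (y - unitVec μ)).symm (toLp 2 (cv (h (c (y - unitVec μ))))))) =
        toLp 2 ((∑ b : PBond P i, if b ∈ S ∧ b.src = c y then cv (V b * h b.tgt * (W b)⁻¹) else 0) +
          ∑ b : PBond P i, if b ∈ S ∧ b.tgt = c y then cv ((V b)⁻¹ * h b.src * W b) else 0) := by
      rw [hsrc, htgt, toLp_add, Finset.sum_add_distrib]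
      have e1 : ∀ s : Finset (Fin P.d), ∀ F : Fin P.d → (Fin 4 → ℝ), toLp 2 (∑ μ ∈ s, F μ) = ∑ μ ∈ s, toLp 2 (F μ) := by
        intro s F
        induction s using Finset.induction_on with
        | empty => simp
        | insert a s ha ih => rw [Finset.sum_insert ha, Finset.sum_insert ha, toLp_add, ih]
      rw [e1, e1]
      congr 1
      · exact Finset.sum_congr rfl fun μ _ => hτ μ y _
      · exact Finset.sum_congr rfl fun μ _ => hτs μ (y - unitVec μ) _
    change ‖∑ μ, (τ μ y (toLp 2 (cv (h (c (y + unitVec μ))))) + (τ μ (y - unitVec μ)).symm (toLp 2 (cv (h (c (y - unitVec μ))))))‖ •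
        toLp 2 (cv (h (c y))) = _
    rw [hN]
    set N := (∑ b : PBond P i, if b ∈ S ∧ b.src = c y then cv (V b * h b.tgt * (W b)⁻¹) else 0) +
          ∑ b : PBond P i, if b ∈ S ∧ b.tgt = c y then cv ((V b)⁻¹ * h b.src * W b) else 0 with hNdef
    have hnorm : ‖toLp 2 N‖ = Real.sqrt (N ⬝ᵥ N) := by
      rw [← norm_toLp_sq_eq_dot, Real.sqrt_sq (norm_nonneg _)]
    rw [hnorm, ← toLp_smul]
    exact congrArg (toLp 2) hEL


/-! ## §2 ★★★ Local minimality of the flat shadow under sphere-valued variations supported in a charted box -/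

/-- `gaugeAct k (gaugeAct h W) = gaugeAct (k·h) W` bondwise. [cite: Balaban1985Averaging, (8) p.18] -/
theorem gaugeAct_gaugeAct_apply {G : Type*} [GaugeGroup G] (k h : GaugeTransf P i G) (W : GaugeField P i G) (b : PBond P i) :
    GaugeField.gaugeAct k (GaugeField.gaugeAct h W) b = GaugeField.gaugeAct (fun x => k x * h x) W b := by
  simp only [GaugeField.gaugeAct, _root_.mul_inv_rev, mul_assoc]

/-- `Σ_b (if b ∈ S then f b else 0) = Σ_{b ∈ S} f b`. [folklore] -/
theorem sum_ite_mem_univ [DecidableEq (PBond P i)] (S : Finset (PBond P i)) (f : PBond P i → ℝ) :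
    (∑ b : PBond P i, if b ∈ S then f b else 0) = ∑ b ∈ S, f b := by
  rw [Finset.sum_ite_mem, Finset.univ_inter]

/-- ★★★ **LOCAL MINIMALITY OF THE FLAT SHADOW.**  In the setting of `exists_flatShadow` (only its outputs (a₀) `u(y) = v(h(c y))` and (b′) the energy
dictionary for EVERY gauge transformation are used): if the chart `c` is injective on `Q_{R+2}(z)` and every chart bond `⟨c y, μ⟩`, `y ∈ Q_{R+1}(z)`, lies in
`S`, then `u` minimises the twisted energy `Σ_{y∈Q_{R+1}(z)}Σ_μ ‖τ μ y (·(y+e_μ)) − ·(y)‖²` among all fields `v` that agree with `u` off `Q_R(z)` and are unit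
on `Q_R(z)` — because every such `v` is the flat shadow of a gauge copy `(k·h)` with `k = 1` off `c(Q_R(z))` (✓`exists_su2_coords_eq`), the `S`-terms off the
chart bonds of `Q_{R+1}(z)` are untouched, and `h` is `S`-orbit-minimal.  This is the minimality clause the E→R one-step improvement consumes.
[cite: SchoenUhlenbeck1982, §2; Giaquinta1984, Ch. III §1 p.64] -/
theorem localMin_of_dictionary [DecidableEq (PBond P i)]
    (V W : GaugeField P i (Matrix.specialUnitaryGroup (Fin 2) ℂ)) (S : Finset (PBond P i))
    (h : GaugeTransf P i (Matrix.specialUnitaryGroup (Fin 2) ℂ))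
    (hmin : ∀ k : GaugeTransf P i (Matrix.specialUnitaryGroup (Fin 2) ℂ),
      (∑ b : PBond P i, if b ∈ S then GaugeGroup.dist1 (V b * (GaugeField.gaugeAct h W b)⁻¹) ^ 2 else 0) ≤
        ∑ b : PBond P i, if b ∈ S then GaugeGroup.dist1 (V b * (GaugeField.gaugeAct k (GaugeField.gaugeAct h W) b)⁻¹) ^ 2 else 0)
    (c : Zd P.d → Site P i) (hc : ∀ y μ, c (y + unitVec μ) = Site.shift (c y) μ)
    (u : Zd P.d → EuclideanSpace ℝ (Fin 4)) (τ : Fin P.d → Zd P.d → (EuclideanSpace ℝ (Fin 4) ≃ₗᵢ[ℝ] EuclideanSpace ℝ (Fin 4)))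
    (hu : ∀ y, u y = toLp 2 ![(((h (c y) : Matrix.specialUnitaryGroup (Fin 2) ℂ) : Matrix (Fin 2) (Fin 2) ℂ) 0 0).re,
          (((h (c y) : Matrix.specialUnitaryGroup (Fin 2) ℂ) : Matrix (Fin 2) (Fin 2) ℂ) 0 0).im,
          (((h (c y) : Matrix.specialUnitaryGroup (Fin 2) ℂ) : Matrix (Fin 2) (Fin 2) ℂ) 1 0).re,
          (((h (c y) : Matrix.specialUnitaryGroup (Fin 2) ℂ) : Matrix (Fin 2) (Fin 2) ℂ) 1 0).im])
    (hdict : ∀ (h' : GaugeTransf P i (Matrix.specialUnitaryGroup (Fin 2) ℂ)) (y : Zd P.d) (μ : Fin P.d),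
        ‖τ μ y (toLp 2 ![(((h' (c (y + unitVec μ)) : Matrix.specialUnitaryGroup (Fin 2) ℂ) : Matrix (Fin 2) (Fin 2) ℂ) 0 0).re,
              (((h' (c (y + unitVec μ)) : Matrix.specialUnitaryGroup (Fin 2) ℂ) : Matrix (Fin 2) (Fin 2) ℂ) 0 0).im,
              (((h' (c (y + unitVec μ)) : Matrix.specialUnitaryGroup (Fin 2) ℂ) : Matrix (Fin 2) (Fin 2) ℂ) 1 0).re,
              (((h' (c (y + unitVec μ)) : Matrix.specialUnitaryGroup (Fin 2) ℂ) : Matrix (Fin 2) (Fin 2) ℂ) 1 0).im]) -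
            toLp 2 ![(((h' (c y) : Matrix.specialUnitaryGroup (Fin 2) ℂ) : Matrix (Fin 2) (Fin 2) ℂ) 0 0).re,
              (((h' (c y) : Matrix.specialUnitaryGroup (Fin 2) ℂ) : Matrix (Fin 2) (Fin 2) ℂ) 0 0).im,
              (((h' (c y) : Matrix.specialUnitaryGroup (Fin 2) ℂ) : Matrix (Fin 2) (Fin 2) ℂ) 1 0).re,
              (((h' (c y) : Matrix.specialUnitaryGroup (Fin 2) ℂ) : Matrix (Fin 2) (Fin 2) ℂ) 1 0).im]‖ ^ 2 =
          GaugeGroup.dist1 (V ⟨c y, μ⟩ * (GaugeField.gaugeAct h' W ⟨c y, μ⟩)⁻¹) ^ 2)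
    (z : Zd P.d) (R : ℤ) (hinj : Set.InjOn c ↑(box z (R + 2))) (hS : ∀ y ∈ box z (R + 1), ∀ μ, (⟨c y, μ⟩ : PBond P i) ∈ S)
    (v : Zd P.d → EuclideanSpace ℝ (Fin 4)) (hv : ∀ y, y ∉ box z R → v y = u y) (hv1 : ∀ y ∈ box z R, ‖v y‖ = 1) :
    ∑ y ∈ box z (R + 1), ∑ μ, ‖τ μ y (u (y + unitVec μ)) - u y‖ ^ 2 ≤
      ∑ y ∈ box z (R + 1), ∑ μ, ‖τ μ y (v (y + unitVec μ)) - v y‖ ^ 2 := by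
  classical
  set cv : Matrix.specialUnitaryGroup (Fin 2) ℂ → (Fin 4 → ℝ) := fun g =>
    ![((g : Matrix (Fin 2) (Fin 2) ℂ) 0 0).re, ((g : Matrix (Fin 2) (Fin 2) ℂ) 0 0).im,
      ((g : Matrix (Fin 2) (Fin 2) ℂ) 1 0).re, ((g : Matrix (Fin 2) (Fin 2) ℂ) 1 0).im] with hcv
  have hR01 : box z R ⊆ box z (R + 1) := box_mono z (by linarith)
  have hR12 : box z (R + 1) ⊆ box z (R + 2) := box_mono z (by linarith)
  have hR02 : box z R ⊆ box z (R + 2) := hR01.trans hR12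
  -- `SU(2)` coordinates of the competitor on `Q_R(z)`
  have hcoord : ∀ y, ∃ g : Matrix.specialUnitaryGroup (Fin 2) ℂ, y ∈ box z R → toLp 2 (cv g) = v y := by
    intro y
    by_cases hy : y ∈ box z R
    · have h1 : ofLp (v y) ⬝ᵥ ofLp (v y) = 1 := by
        have := norm_toLp_sq_eq_dot (ofLp (v y))
        rw [toLp_ofLp, hv1 y hy, one_pow] at this
        exact this.symm
      obtain ⟨g, hg⟩ := exists_su2_coords_eq _ h1
      exact ⟨g, fun _ => by rw [show cv g = ofLp (v y) from hg, toLp_ofLp]⟩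
    · exact ⟨1, fun h => absurd h hy⟩
  choose g hg using hcoord
  -- the competitor gauge transformation
  let k : GaugeTransf P i (Matrix.specialUnitaryGroup (Fin 2) ℂ) := fun x =>
    if hx : ∃ y ∈ box z R, c y = x then g (Classical.choose hx) * (h x)⁻¹ else 1
  have hk_in : ∀ y ∈ box z R, k (c y) * h (c y) = g y := by
    intro y hy
    have hx : ∃ y' ∈ box z R, c y' = c y := ⟨y, hy, rfl⟩
    have hsel := Classical.choose_spec hx
    have hyy : Classical.choose hx = y := hinj (hR02 hsel.1) (hR02 hy) hsel.2
    show (if hx : ∃ y' ∈ box z R, c y' = c y then g (Classical.choose hx) * (h (c y))⁻¹ else 1) * h (c y) = g y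
    rw [dif_pos hx, hyy, inv_mul_cancel_right]
  have hk_out : ∀ x, (¬ ∃ y ∈ box z R, c y = x) → k x = 1 := fun x hx => dif_neg hx
  -- the gauge copy `h' = k·h` and its flat shadow equals `v` on `Q_{R+2}(z)`
  set h' : GaugeTransf P i (Matrix.specialUnitaryGroup (Fin 2) ℂ) := fun x => k x * h x with hh'
  have hval : ∀ y ∈ box z (R + 2), toLp 2 (cv (h' (c y))) = v y := by
    intro y hy
    by_cases hyR : y ∈ box z R
    · show toLp 2 (cv (k (c y) * h (c y))) = v y
      rw [hk_in y hyR]; exact hg y hyR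
    · have hno : ¬ ∃ y' ∈ box z R, c y' = c y := by
        rintro ⟨y', hy', hcy⟩
        exact hyR (by rwa [← hinj (hR02 hy') hy hcy])
      show toLp 2 (cv (k (c y) * h (c y))) = v y
      rw [hk_out _ hno, one_mul, ← hu, hv y hyR]
  -- per-bond terms on the chart bonds of `Q_{R+1}(z)`
  have hU : ∀ y ∈ box z (R + 1), ∀ μ, ‖τ μ y (u (y + unitVec μ)) - u y‖ ^ 2 =
      GaugeGroup.dist1 (V ⟨c y, μ⟩ * (GaugeField.gaugeAct h W ⟨c y, μ⟩)⁻¹) ^ 2 := by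
    intro y _ μ; rw [hu, hu]; exact hdict h y μ
  have hV : ∀ y ∈ box z (R + 1), ∀ μ, ‖τ μ y (v (y + unitVec μ)) - v y‖ ^ 2 =
      GaugeGroup.dist1 (V ⟨c y, μ⟩ * (GaugeField.gaugeAct h' W ⟨c y, μ⟩)⁻¹) ^ 2 := by
    intro y hy μ
    have hm : y + unitVec μ ∈ box z (R + 2) := by
      have := add_unitVec_mem_box hy μ
      rwa [show R + 1 + 1 = R + 2 by ring] at this
    rw [← hval y (hR12 hy), ← hval (y + unitVec μ) hm]
    exact hdict h' y μ
  -- the chart bonds of `Q_{R+1}(z)` as a finset of torus bonds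
  set B₁ : Finset (PBond P i) := (box z (R + 1) ×ˢ (Finset.univ : Finset (Fin P.d))).image fun p => (⟨c p.1, p.2⟩ : PBond P i)
    with hB₁
  have hB₁S : B₁ ⊆ S := by
    intro b hb
    obtain ⟨p, hp, rfl⟩ := Finset.mem_image.mp hb
    exact hS p.1 (Finset.mem_product.mp hp).1 p.2
  have hinjB : Set.InjOn (fun p : Zd P.d × Fin P.d => (⟨c p.1, p.2⟩ : PBond P i)) ↑(box z (R + 1) ×ˢ (Finset.univ : Finset (Fin P.d))) := by
    intro p hp q hq hpq
    have h1 : c p.1 = c q.1 := congrArg PBond.src hpq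
    have h2 : p.2 = q.2 := congrArg PBond.dir hpq
    have hp1 : p.1 ∈ box z (R + 2) := hR12 (Finset.mem_product.mp (Finset.mem_coe.mp hp)).1
    have hq1 : q.1 ∈ box z (R + 2) := hR12 (Finset.mem_product.mp (Finset.mem_coe.mp hq)).1
    exact Prod.ext (hinj hp1 hq1 h1) h2
  have hsumB : ∀ F : PBond P i → ℝ, ∑ b ∈ B₁, F b = ∑ y ∈ box z (R + 1), ∑ μ, F ⟨c y, μ⟩ := by
    intro F
    rw [hB₁, Finset.sum_image hinjB, Finset.sum_product]
  -- off the chart bonds the competitor's terms are untouched (`k = 1` at both endpoints)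
  have hoff : ∀ b ∈ S, b ∉ B₁ →
      GaugeGroup.dist1 (V b * (GaugeField.gaugeAct h' W b)⁻¹) ^ 2 = GaugeGroup.dist1 (V b * (GaugeField.gaugeAct h W b)⁻¹) ^ 2 := by
    intro b _ hbB
    have hs : k b.src = 1 := by
      refine hk_out _ ?_
      rintro ⟨y, hy, hcy⟩
      refine hbB (Finset.mem_image.mpr ⟨(y, b.dir), Finset.mem_product.mpr ⟨hR01 hy, Finset.mem_univ _⟩, ?_⟩)
      cases b; simp only at hcy ⊢; rw [hcy]
    have ht : k b.tgt = 1 := by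
      refine hk_out _ ?_
      rintro ⟨y, hy, hcy⟩
      have hsrc : b.src = c (y - unitVec b.dir) := src_eq_chart_sub_of_tgt_eq hc hcy.symm
      refine hbB (Finset.mem_image.mpr ⟨(y - unitVec b.dir, b.dir), Finset.mem_product.mpr ⟨?_, Finset.mem_univ _⟩, ?_⟩)
      · exact sub_unitVec_mem_box hy b.dir
      · cases b; simp only at hsrc ⊢; rw [hsrc]
    show GaugeGroup.dist1 (V b * (k b.src * h b.src * W b * (k b.tgt * h b.tgt)⁻¹)⁻¹) ^ 2 =
      GaugeGroup.dist1 (V b * (h b.src * W b * (h b.tgt)⁻¹)⁻¹) ^ 2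
    rw [hs, ht, one_mul, one_mul]
  -- the `S`-orbit minimality of `h` against the competitor `k`
  have hmk := hmin k
  simp_rw [gaugeAct_gaugeAct_apply k h W] at hmk
  rw [sum_ite_mem_univ, sum_ite_mem_univ] at hmk
  -- split both `S`-sums along `B₁ ⊆ S`
  have hsplit : ∑ b ∈ S, (GaugeGroup.dist1 (V b * (GaugeField.gaugeAct h' W b)⁻¹) ^ 2 -
      GaugeGroup.dist1 (V b * (GaugeField.gaugeAct h W b)⁻¹) ^ 2) =
      ∑ b ∈ B₁, (GaugeGroup.dist1 (V b * (GaugeField.gaugeAct h' W b)⁻¹) ^ 2 -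
        GaugeGroup.dist1 (V b * (GaugeField.gaugeAct h W b)⁻¹) ^ 2) :=
    (Finset.sum_subset hB₁S fun b hbS hbB => by rw [hoff b hbS hbB, sub_self]).symm
  have hle : 0 ≤ ∑ b ∈ B₁, (GaugeGroup.dist1 (V b * (GaugeField.gaugeAct h' W b)⁻¹) ^ 2 -
      GaugeGroup.dist1 (V b * (GaugeField.gaugeAct h W b)⁻¹) ^ 2) := by
    rw [← hsplit, Finset.sum_sub_distrib]
    exact sub_nonneg.mpr hmk
  rw [hsumB] at hle
  have hL : ∑ y ∈ box z (R + 1), ∑ μ, ‖τ μ y (u (y + unitVec μ)) - u y‖ ^ 2 =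
      ∑ y ∈ box z (R + 1), ∑ μ, GaugeGroup.dist1 (V ⟨c y, μ⟩ * (GaugeField.gaugeAct h W ⟨c y, μ⟩)⁻¹) ^ 2 :=
    Finset.sum_congr rfl fun y hy => Finset.sum_congr rfl fun μ _ => hU y hy μ
  have hRt : ∑ y ∈ box z (R + 1), ∑ μ, ‖τ μ y (v (y + unitVec μ)) - v y‖ ^ 2 =
      ∑ y ∈ box z (R + 1), ∑ μ, GaugeGroup.dist1 (V ⟨c y, μ⟩ * (GaugeField.gaugeAct h' W ⟨c y, μ⟩)⁻¹) ^ 2 :=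
    Finset.sum_congr rfl fun y hy => Finset.sum_congr rfl fun μ _ => hV y hy μ
  rw [hL, hRt]
  have : ∑ y ∈ box z (R + 1), ∑ μ, (GaugeGroup.dist1 (V ⟨c y, μ⟩ * (GaugeField.gaugeAct h' W ⟨c y, μ⟩)⁻¹) ^ 2 -
      GaugeGroup.dist1 (V ⟨c y, μ⟩ * (GaugeField.gaugeAct h W ⟨c y, μ⟩)⁻¹) ^ 2) =
      (∑ y ∈ box z (R + 1), ∑ μ, GaugeGroup.dist1 (V ⟨c y, μ⟩ * (GaugeField.gaugeAct h' W ⟨c y, μ⟩)⁻¹) ^ 2) -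
        ∑ y ∈ box z (R + 1), ∑ μ, GaugeGroup.dist1 (V ⟨c y, μ⟩ * (GaugeField.gaugeAct h W ⟨c y, μ⟩)⁻¹) ^ 2 := by
    rw [← Finset.sum_sub_distrib]
    exact Finset.sum_congr rfl fun y _ => Finset.sum_sub_distrib _ _
  linarith


end Summit.QuantumFields.YangMills.Theorems.PoincareLipschitzOrbitMinFlatShadow

end
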